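import Summits.BirchSwinnertonDyer.BirchSwinnertonDyer.Theorems.KatoDescentTamePotSupersingularTameUpperUnitTwistRecordRoads
import HarnessLib

/-!
# Route `KatoDescentPotSupersingular` (rung K9, sub-rung B5 O6 wild `p = 3`, cell `bsd-potss`): the ♭ UNIT-TWIST road of the
# U₀-ns node in RECORD-INPUT form for an ODD Heegner discriminant (seat `bsd-potss-k9-c4` g16; route-free; a certificate shape —
# nothing booked, no item closed, BSD is not proved by any of this)

WHY. The per-row kernel RECORDS of the K9 U₀-ns rows (items 19189 `WildUpperNonsurjTower` / 19197 `WildUpperDefectRankZero`: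
rank `0`, wild additive potentially supersingular `3` (`v₃(N) ∈ {3,4,5}`), `E[3]` irreducible, `3`-adic tower not onto) instantiate,
on the ♭ rows (`3 ∤ ∏ c_ℓ(E)`), kmc's F15
`AdditiveUnitTwistCertificate.missingUpperBoundAt_rankZero_irreducible_at_unitTwistDatum_of_matarNekovar` (p574309; PUBLISHED
inputs only: Gross–Zagier, Kolyvagin, Matar–Nekovář 2019 Thm 0.3, GZK, modularity).  k8t-c4 g14's record-input form
`TameUpperUnitTwistRecords.missingUpperBoundAt_flat_of_datum_of_unitTwist` (§1 of `…TameUpperUnitTwistRecordRoads`) asks for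
`d_K ≡ 1 (mod 8)`; F15 itself only needs `d_K` ODD (and the Heegner hypothesis at level `N(E)`, which already forces `d_K ≡ 1 (mod 8)`
whenever `2 ∣ N(E)`).  On the K9 census (kmc g21, kit j295376) 54 of the 255 certified rows have ODD conductor, and for 34 of them the
certifying twist has `d_K ≡ 5 (mod 8)`; this file records the same road with the hypothesis `Odd d_K` so that those rows need no
second twist search.  Everything else is §1 verbatim (Heegner datum, embedding, `K`-rational Heegner point, `L(E,1)/Ω(E) ∈ ℚ` by
Manin–Drinfeld at the displayed datum `D` are DERIVED by tree theorems).

* `missingUpperBoundAt_flat_of_datum_of_unitTwist_odd` — ♭ road in record-input form, `Odd d_K` variant (over F15).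

HONEST FRAMING: CONDITIONAL on every displayed hypothesis (named published facts; the twist's analytic rank and `#Ш_an` are NUMERICAL
data displayed as hypotheses by the records); per-ROW statements (never a ∀-item); closes nothing; 0 definitions, 0 named facts
minted, 0 `sorry`.

References: [MatarNekovar2019] Thm. 0.3, §0.11; [GrossZagier1986] I.6.3, V.§2; [KolyvaginEulerSystems1990] Thm. A; [GrossLMS1991] §1;
[Manin1972] Cor. 3.6; [EdixhovenManin1991] §1; [Miller2011LMS] Def. 1.1.
-/

set_option autoImplicit false
-- the Theorems directory repeats the summit name (sibling precedent `KatoDescentPotSupersingularAssembly.lean`)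
set_option linter.dupNamespace false

noncomputable section

open scoped Classical NumberField

namespace Summit.BirchSwinnertonDyer.BirchSwinnertonDyer.Theorems.WildUpperUnitTwistRecords

open WeierstrassCurve IsDedekindDomain IsDedekindDomain.HeightOneSpectrum NumberField
  Rat.HeightOneSpectrum Literature.NumberTheory.EllipticCurves
  Literature.NumberTheory.EllipticCurves.ModularForms
  Literature.NumberTheory.DiophantineGeometry
  Literature.NumberTheory.EllipticCurves.Rank1Residual
  Literature.NumberTheory.EllipticCurves.Rank1Residual.Typed
  Literature.NumberTheory.Automorphic Literature.NumberTheory.EllipticCurves.KrizLi2019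
  Literature.NumberTheory.QuadraticFields
  Summit.BirchSwinnertonDyer.Rank1Residual
  Summit.BirchSwinnertonDyer.Rank1Residual.Additive
  Summit.BirchSwinnertonDyer.BirchSwinnertonDyer.Theorems
  Summit.BirchSwinnertonDyer.BirchSwinnertonDyer.Theorems.TameUpperHeegnerSharpRoad

/-- **♭ UNIT-TWIST ROAD, record-input form, ODD-discriminant variant.** For a globally minimal `W` of conductor `N` (`hN`), an odd
prime `p ∣ N`, `r_an(W) = 0`, `W[p]` irreducible, `p ∤ ∏ c_ℓ(W)`; a modular parametrisation datum `D` of level `N` with `p ∤ c(D)`; a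
quadratic imaginary `K` satisfying the Heegner hypothesis at level `N` with `d_K` ODD and `d_K < −4`; a globally minimal `Wd` with
`Cd • W^{(d_K)} = Wd`, `r_an(Wd) = 1` and `#Ш_an(Wd) = qd ∈ ℚ` of `p`-adic valuation `≤ 0` — the UPPER half `MissingUpperBoundAt W p`,
modulo the PUBLISHED inputs Gross–Zagier (`hGZ`), Kolyvagin (`hKo`), Matar–Nekovář 2019 Thm 0.3 (`hMN`), GZK (`hGZK`), modularity
(`hmod`).  Proof = k8t-c4 g14's §1 verbatim with `Odd d_K` in place of `d_K ≡ 1 (mod 8)`: the Heegner datum `H` (from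
`β² ≡ d_K (mod 4N)`), an embedding `ι : K → ℂ`, the `K`-rational Heegner point `P` of `D` and `L(W,1)/Ω(W) = [0]⁺·ϖ ∈ ℚ`
(Manin–Drinfeld at `D`) are produced by tree theorems and fed to F15
`AdditiveUnitTwistCertificate.missingUpperBoundAt_rankZero_irreducible_at_unitTwistDatum_of_matarNekovar`.
CONDITIONAL on the displayed hypotheses; per row; closes nothing. [cite: MatarNekovar2019, Thm. 0.3 (p. 456), §0.11 (p. 457)]
[cite: GrossZagier1986, Thm. I.6.3, V.§2] [cite: Manin1972, Cor. 3.6] [cite: EdixhovenManin1991, §1] [cite: Miller2011LMS, Def. 1.1] -/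
theorem missingUpperBoundAt_flat_of_datum_of_unitTwist_odd
    (hGZ : ∀ (N : ℕ) [NeZero N] (W : WeierstrassCurve ℚ) (K : Type) [Field K] [NumberField K],
      gross_zagier N W K)
    (hKo : ∀ (N : ℕ) [NeZero N] (W : WeierstrassCurve ℚ) (K : Type) [Field K] [NumberField K],
      kolyvagin N W K)
    (hMN : ∀ (N : ℕ) [NeZero N] (W : WeierstrassCurve ℚ) (K : Type) [Field K] [NumberField K],
      MatarNekovar2019.thm03_padicValNat_card_sha_le_of_irreducible N W K)
    (hGZK : rank_eq_analyticRank_of_analyticRank_le_one) (hmod : hasEntireLFunction_rat)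
    (W : WeierstrassCurve ℚ) [W.IsElliptic] [W.IsGloballyMinimal] (p : ℕ) [Fact p.Prime] (hp2 : p ≠ 2)
    {N : ℕ} [NeZero N] (hN : W.conductorNorm ℤ = N) (hpN : p ∣ N)
    (hr : W.analyticRank = 0) (hirr : W.HasIrreducibleModPGaloisRep p) (htam : ¬ p ∣ W.tamagawaProduct)
    (D : ModularParametrizationData W N) (hc : ¬ (p : ℤ) ∣ D.c)
    (K : Type) [Field K] [NumberField K] (hK : IsImaginaryQuadratic K) (hHN : SatisfiesHeegnerHypothesis N K)
    (hodd : Odd (NumberField.discr K)) (hd4 : NumberField.discr K < -4)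
    (Wd : WeierstrassCurve ℚ) [Wd.IsElliptic] [Wd.IsGloballyMinimal] (Cd : VariableChange ℚ)
    (hWd : Cd • W.quadraticTwist (NumberField.discr K : ℚ) = Wd) (hrd : Wd.analyticRank = 1)
    {qd : ℚ} (hqd : shaAn Wd = (qd : ℂ)) (hvd : padicValRat p qd ≤ 0) :
    MissingUpperBoundAt W p := by
  -- the Heegner datum and the `K`-rational Heegner point of the datum `D` (tree theorems)
  obtain ⟨β, hβ⟩ := exists_dvd_sq_sub_discr_holds N K hK hHN
  obtain ⟨H, -⟩ := nonempty_heegnerDatum_holds N K hK hβ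
  obtain ⟨ι⟩ : Nonempty (K →+* ℂ) := inferInstance
  obtain ⟨P, hP⟩ := heegnerPointComplex_mem_range_map_holds N W K hK hHN D H ι
  -- rationality of `L(W,1)/Ω(W)`: Manin–Drinfeld at the datum `D` (tree theorems; NO L₀ input)
  obtain ⟨q0, hq0⟩ : ∃ q0 : ℚ, W.entireLFunction 1 / (W.realPeriodRat : ℂ) = (q0 : ℂ) := by
    obtain ⟨ϖ, -, hϖ, hΩ⟩ := D.exists_rat_mul_realPeriodRat_eq_plusPeriod
    refine ⟨ratPlusSymbol D.f 0 * ϖ, ?_⟩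
    have hΩ0 : (W.realPeriodRat : ℂ) ≠ 0 := by exact_mod_cast hΩ.ne'
    rw [div_eq_iff hΩ0, D.isNewformOf.entireLFunction_one_eq, ← hϖ]
    push_cast
    ring
  exact AdditiveUnitTwistCertificate.missingUpperBoundAt_rankZero_irreducible_at_unitTwistDatum_of_matarNekovar W p hp2
    hN hpN K D H ι P (hGZ N W K) (hKo N W K) (hMN N W K) hGZK hmod hK hHN hodd hd4 hP hc
    hr hirr htam q0 hq0 Wd ⟨Cd, hWd⟩ hrd ⟨qd, hqd, hvd⟩

end Summit.BirchSwinnertonDyer.BirchSwinnertonDyer.Theorems.WildUpperUnitTwistRecords
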